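import Literature.Computability.AlgebraicComplexity.BCMV25PermanentalVarieties
import Literature.Computability.AlgebraicComplexity.ABV17SingularLocusBound
import HarnessLib

/-!
# Alper–Bogart–Velasco 2017, §1: `codim Sing(perm_3) = 6` (characteristic `≠ 2`)

Topic `Literature/Computability/AlgebraicComplexity`; theorem-only file (no definitions, no named
facts), completing the dictionary row ABV2017-A.

Alper–Bogart–Velasco 2017, §1 (arXiv:1505.02205 text p0003 L38): "Since it can be readily
computed that `codim(Sing(perm_3)) = 6` and `codim(Sing(perm_4)) = 8` (c.f. [von-zur-gathen]), we
obtain: Corollary 1.4."  Boralevi–Carlini–Michałek–Ventura 2025, §4.5 (arXiv:2402.17839 text p0012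
L36–41): von zur Gathen's theorem gives `5 ≤ codim Sing(per_k) ≤ 2k` for `k ≥ 3`, and "the
codimension of this set is currently unknown for `k ≥ 5`".

In the tree's conventions (`CHECK-t13-ABV17`): `codim Sing(f) = (singIdeal f).height`,
`singIdeal (perPoly (Fin 3) F) = VonZurGathen.singPermIdeal F 3` (`singIdeal_perPoly`, `rfl`)
`= subpermIdeal F 3 3 2`, the ideal of the nine `2 × 2` permanents of the generic `3 × 3` matrix
(`BoraleviCarliniMichalekVentura2025.singPermIdeal_eq_subpermIdeal`).

## What is typed

* `AlperBogartVelasco.height_ker_aeval_ge_of_threeByThree` — the computation at a point: if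
  all `2 × 2` permanents of a `3 × 3` matrix `a` over a domain `L ⊇ K` vanish and `2 ≠ 0` in `K`,
  the prime `{f : f(a) = 0} ⊆ K[X_{3×3}]` has height `≥ 6`.  Elementary case analysis in the style
  of the tree's `height_ker_aeval_ge_of_twoByN` (BCMV Thm. 2.1 at a point): either every row of
  `a` has at most one nonzero entry (six vanishing coordinates), or some row `r` has
  `a_{rc} a_{rd} ≠ 0`; then every other row is either zero or has `a_{sc} a_{sd} ≠ 0` with the
  third column dead in both rows (`2 a_{rd} a_{rj} a_{sc} = 0`), two such rows are impossible
  (`2 a_{rd} a_{sc} a_{tc} = 0`), and one such row leaves five vanishing coordinates plus the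
  relation `a_{rc} a_{sd} + a_{rd} a_{sc} = 0` as a sixth strict step of the chain.
* `AlperBogartVelasco.six_le_height_of_subpermIdeal_three_le` — every prime of `F[X_{3×3}]`
  containing the `2 × 2` permanents has height `≥ 6` (`2 ≠ 0` in `F`, any field).
* `BoraleviCarliniMichalekVentura2025.height_subpermIdeal_three_three_two` —
  `ht (subpermIdeal F 3 3 2) = 6`; the upper bound is the tree's `alperBogartVelasco2017_rem_1_5`
  (two zero columns) through the bridge `singPermIdeal_eq_subpermIdeal`.
* `height_singPermIdeal_three` — AS PRINTED: `codim Sing(perm_3) = 6`, i.e.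
  `(VonZurGathen.singPermIdeal F 3).height = 6` (`= (singIdeal (perPoly (Fin 3) F)).height` by
  `singIdeal_perPoly`, `rfl`), for every field `F` with `(2 : F) ≠ 0`.  The hypothesis is
  necessary in substance: in characteristic `2`, `per₃ = det₃`, `Sing(det₃) = {rk ≤ 1}` has
  codimension `4`.
* `BoraleviCarliniMichalekVentura2025.thm_4_14` — the numbered frame, BY CITATION of tree
  theorems: BCMV Thm. 4.14 (von zur Gathen) "`Sing(P) = {prk(M) ≤ k−2}` has codimension between
  `5` and `2k`" (`k ≥ 3`), as `5 ≤ ht (singPermIdeal F k) ≤ 2k` under `(2 : F) ≠ 0` (printed over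
  `ℂ`): lower bound = the tree's `five_le_height_singIdeal_perPoly` (vzG Lemma 2.3,
  `vonzurGathen1987_singPerm_height_holds`), upper bound = `alperBogartVelasco2017_rem_1_5`.

With `alperBogartVelasco2017_cor_1_3` (`dc(per_n) ≥ codim Sing(per_n) + 1`, tree) this is ABV's
own printed route to `dc(perm_3) ≥ 7`; the tree's `alperBogartVelasco2017_cor_1_4_holds` reaches
`dc(perm_3) = 7` by another route and is NOT restated here.

## What is NOT typed

* the second clause `codim(Sing(perm_4)) = 8` (sixteen cubics in sixteen variables; a computer
  algebra computation in print, c.f. von zur Gathen 1987);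
* any statement for `k ≥ 5` (open, BCMV 2025 §4.5).

Honest framing: V0 dictionary completion (rows ABV2017-A / BCMV25-A, the case `k = 3` of von zur
Gathen's problem); no rung of any route moves; VP ≠ VNP is NOT proved.

## References

* J. Alper, T. Bogart, M. Velasco, *A lower bound for the determinantal complexity of a
  hypersurface*, Found. Comput. Math. 17 (2017) 829–836, arXiv:1505.02205: §1 (text p0003 L38),
  Cor. 1.3, Cor. 1.4, Rem. 1.5. [AlperBogartVelasco2017]
* A. Boralevi, E. Carlini, M. Michałek, E. Ventura, *On the codimension of permanental
  varieties*, Adv. Math. 461 (2025), arXiv:2402.17839: §4.5, Thm. 4.14 (text p0012 L36–41).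
  [BoraleviCarliniMichalekVentura2025]
* J. von zur Gathen, *Permanent and determinant*, Linear Algebra Appl. 96 (1987) 87–100, Lemma
  2.3 (`codim Sing(per_k) ≥ 5`; the tree's `vonzurGathen1987_singPerm_height_holds` /
  `five_le_height_singIdeal_perPoly`). [Vonzurgathen1987]
-/

noncomputable section

open Matrix MvPolynomial Finset

namespace Literature.Computability.AlgebraicComplexity

open VonZurGathen BoraleviCarliniMichalekVentura2025

namespace AlperBogartVelasco

/-- Two further indices in `Fin 3`. [folklore] -/
private theorem fin3_exists_others : ∀ r : Fin 3, ∃ s t : Fin 3, s ≠ r ∧ t ≠ r ∧ s ≠ t := by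
  decide

/-- A third index in `Fin 3`. [folklore] -/
private theorem fin3_exists_ne_ne : ∀ c d : Fin 3, ∃ e : Fin 3, e ≠ c ∧ e ≠ d := by
  decide

variable {K : Type*} [Field K] {L : Type*} [CommRing L] [IsDomain L] [Algebra K L]

/-- **`codim Sing(perm_3) ≥ 6` at a point** ("it can be readily computed that
`codim(Sing(perm_3)) = 6`", ABV §1): if all `2 × 2` permanents
`a_{ri} a_{sj} + a_{rj} a_{si}` (`r ≠ s`, `i ≠ j`) of a `3 × 3` matrix `a` over a domain `L ⊇ K`
vanish and `2 ≠ 0` in `K`, then the prime `{f : f(a) = 0} ⊆ K[X_{3×3}]` has height `≥ 6`.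
Case analysis: either every row has at most one nonzero entry (six zero coordinates); or a row
`r` has `a_{rc}, a_{rd} ≠ 0` (`c ≠ d`), and then any other row `s` is zero as soon as
`a_{sc} = 0`, while `a_{sc} ≠ 0` forces `a_{rj} = a_{sj} = 0` off `{c, d}`
(`a_{rc}(a_{rd} a_{sj} + a_{rj} a_{sd}) = −2 a_{rd} a_{rj} a_{sc}`) and `a_{sd} ≠ 0`; two rows
`s, t` with `a_{sc} a_{tc} ≠ 0` give `a_{rc}(a_{sc} a_{td} + a_{sd} a_{tc}) = −2 a_{rd} a_{sc} a_{tc}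
≠ 0`, impossible; so besides `r` at most one row is nonzero: two zero rows are six zero
coordinates, one zero row `t` gives the five zeros `a_{re}, a_{se}, a_{t·}` and the relation
`a_{rc} a_{sd} + a_{rd} a_{sc} = 0` frees `a_{sd}` as a sixth strict step.
[cite: AlperBogartVelasco2017, §1 (sentence introducing Cor. 1.4), arXiv text p0003 L38] -/
theorem height_ker_aeval_ge_of_threeByThree (h2 : (2 : K) ≠ 0) (a : Fin 3 × Fin 3 → L)
    (hvan : ∀ r s i j : Fin 3, r ≠ s → i ≠ j →
      a (r, i) * a (s, j) + a (r, j) * a (s, i) = 0) :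
    (6 : ℕ∞) ≤ (RingHom.ker (aeval (R := K) a)).height := by
  classical
  have h2L : (2 : L) ≠ 0 := fun h =>
    h2 ((algebraMap K L).injective (by rw [map_ofNat, map_zero]; exact h))
  have zeros : ∀ T : Finset (Fin 3 × Fin 3), (∀ x ∈ T, a x = 0) →
      (T.card : ℕ∞) ≤ (RingHom.ker (aeval (R := K) a)).height :=
    fun T hT => card_le_height_ker_aeval a T hT
  by_cases h1 : ∀ r : Fin 3, ∃ c : Fin 3, ∀ j, j ≠ c → a (r, j) = 0
  · -- every row has at most one nonzero entry: six vanishing coordinates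
    choose c hc using h1
    set G : Finset (Fin 3 × Fin 3) := Finset.univ.image fun r => (r, c r) with hG
    have hGcard : G.card = 3 := by
      rw [hG, Finset.card_image_of_injective _ (fun r r' h => congrArg Prod.fst h),
        Finset.card_univ, Fintype.card_fin]
    refine le_trans ?_ (zeros Gᶜ ?_)
    · rw [Finset.card_compl, hGcard, Fintype.card_prod, Fintype.card_fin]
      exact_mod_cast (by norm_num : 6 ≤ 3 * 3 - 3)
    · rintro ⟨r, j⟩ hx
      refine hc r j fun hj => ?_
      rw [Finset.mem_compl] at hx
      exact hx (Finset.mem_image.2 ⟨r, Finset.mem_univ _, by rw [hj]⟩)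
  · push Not at h1
    obtain ⟨r, hr⟩ := h1
    obtain ⟨c, -, hc⟩ := hr 0
    obtain ⟨d, hdc, hd⟩ := hr c
    -- `a_{rc} ≠ 0`, `a_{rd} ≠ 0`, `d ≠ c`
    have rowA : ∀ s, s ≠ r → a (s, c) = 0 → ∀ j, a (s, j) = 0 := by
      intro s hsr hsc j
      by_cases hjc : j = c
      · rw [hjc]; exact hsc
      · have h := hvan r s c j (Ne.symm hsr) (Ne.symm hjc)
        rw [hsc, mul_zero, add_zero] at h
        exact (mul_eq_zero.1 h).resolve_left hc
    have rowB : ∀ s, s ≠ r → a (s, c) ≠ 0 → ∀ j, j ≠ c → j ≠ d →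
        a (r, j) = 0 ∧ a (s, j) = 0 := by
      intro s hsr hsc j hjc hjd
      have hj := hvan r s c j (Ne.symm hsr) (Ne.symm hjc)
      have hdrel := hvan r s c d (Ne.symm hsr) (Ne.symm hdc)
      have hdj := hvan r s d j (Ne.symm hsr) (Ne.symm hjd)
      have key : a (r, c) * (a (r, d) * a (s, j) + a (r, j) * a (s, d)) =
          -(2 * (a (r, d) * a (r, j)) * a (s, c)) := by
        have e1 : a (r, c) * a (s, j) = -(a (r, j) * a (s, c)) := eq_neg_of_add_eq_zero_left hj
        have e2 : a (r, c) * a (s, d) = -(a (r, d) * a (s, c)) :=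
          eq_neg_of_add_eq_zero_left hdrel
        linear_combination a (r, d) * e1 + a (r, j) * e2
      rw [hdj, mul_zero] at key
      have h0 : 2 * (a (r, d) * a (r, j)) * a (s, c) = 0 := neg_eq_zero.1 key.symm
      have hrj : a (r, j) = 0 := by
        rcases mul_eq_zero.1 h0 with h | h
        · rcases mul_eq_zero.1 h with h' | h'
          · exact absurd h' h2L
          · exact (mul_eq_zero.1 h').resolve_left hd
        · exact absurd h hsc
      refine ⟨hrj, ?_⟩
      rw [hrj, zero_mul, add_zero] at hj
      exact (mul_eq_zero.1 hj).resolve_left hc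
    have twoLive : ∀ s t, s ≠ r → t ≠ r → s ≠ t → a (s, c) ≠ 0 → a (t, c) ≠ 0 → False := by
      intro s t hsr htr hst hsc htc
      have hs := hvan r s c d (Ne.symm hsr) (Ne.symm hdc)
      have ht := hvan r t c d (Ne.symm htr) (Ne.symm hdc)
      have hst' := hvan s t c d hst (Ne.symm hdc)
      have key : a (r, c) * (a (s, c) * a (t, d) + a (s, d) * a (t, c)) =
          -(2 * (a (r, d) * a (s, c)) * a (t, c)) := by
        have e1 : a (r, c) * a (s, d) = -(a (r, d) * a (s, c)) := eq_neg_of_add_eq_zero_left hs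
        have e2 : a (r, c) * a (t, d) = -(a (r, d) * a (t, c)) := eq_neg_of_add_eq_zero_left ht
        linear_combination a (s, c) * e2 + a (t, c) * e1
      rw [hst', mul_zero] at key
      have h0 : 2 * (a (r, d) * a (s, c)) * a (t, c) = 0 := neg_eq_zero.1 key.symm
      rcases mul_eq_zero.1 h0 with h | h
      · rcases mul_eq_zero.1 h with h' | h'
        · exact h2L h'
        · exact (mul_ne_zero hd hsc) h'
      · exact htc h
    -- two zero rows: six vanishing coordinates
    have dead2 : ∀ s t, s ≠ t → (∀ j, a (s, j) = 0) → (∀ j, a (t, j) = 0) →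
        (6 : ℕ∞) ≤ (RingHom.ker (aeval (R := K) a)).height := by
      intro s t hst hs ht
      refine le_trans ?_ (zeros (({s, t} : Finset (Fin 3)) ×ˢ Finset.univ) ?_)
      · rw [Finset.card_product, Finset.card_pair hst, Finset.card_univ, Fintype.card_fin]
        exact_mod_cast (by norm_num : 6 ≤ 2 * 3)
      · rintro ⟨x, j⟩ hx
        have hx1 : x ∈ ({s, t} : Finset (Fin 3)) := (Finset.mem_product.1 hx).1
        rcases Finset.mem_insert.1 hx1 with h | h
        · rw [h]; exact hs j
        · rw [Finset.mem_singleton.1 h]; exact ht j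
    -- one live row `s` (`a_{sc} ≠ 0`) and one zero row `t`: five zeros and one relation
    have live1 : ∀ s t, s ≠ r → t ≠ r → s ≠ t → a (s, c) ≠ 0 → (∀ j, a (t, j) = 0) →
        (6 : ℕ∞) ≤ (RingHom.ker (aeval (R := K) a)).height := by
      intro s t hsr htr hst hsc ht
      obtain ⟨e, hec, hed⟩ := fin3_exists_ne_ne c d
      have hre : a (r, e) = 0 := (rowB s hsr hsc e hec hed).1
      have hse : a (s, e) = 0 := (rowB s hsr hsc e hec hed).2
      set T₀ : Finset (Fin 3 × Fin 3) :=
        insert (r, e) (insert (s, e) (({t} : Finset (Fin 3)) ×ˢ Finset.univ)) with hT₀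
      have hmemT₀ : ∀ x ∈ T₀, x = (r, e) ∨ x = (s, e) ∨ x.1 = t := by
        intro x hx
        rcases Finset.mem_insert.1 hx with h | h
        · exact Or.inl h
        rcases Finset.mem_insert.1 h with h | h
        · exact Or.inr (Or.inl h)
        · exact Or.inr (Or.inr (Finset.mem_singleton.1 (Finset.mem_product.1 h).1))
      have hT₀zero : ∀ x ∈ T₀, a x = 0 := by
        intro x hx
        rcases hmemT₀ x hx with h | h | h
        · rw [h]; exact hre
        · rw [h]; exact hse
        · rw [show x = (t, x.2) from Prod.ext h rfl]; exact ht x.2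
      have hT₀card : T₀.card = 5 := by
        rw [hT₀, Finset.card_insert_of_notMem, Finset.card_insert_of_notMem, Finset.card_product,
          Finset.card_singleton, Finset.card_univ, Fintype.card_fin]
        · intro h
          exact hst (Finset.mem_singleton.1 (Finset.mem_product.1 h).1)
        · intro h
          rcases Finset.mem_insert.1 h with h | h
          · exact hsr.symm (congrArg Prod.fst h)
          · exact htr.symm (Finset.mem_singleton.1 (Finset.mem_product.1 h).1)
      -- no position of the rows `{s, r}` and columns `{d, c}` lies in `T₀`
      have hfree : ∀ x ∈ T₀, x.1 ∈ insert s ({r} : Finset (Fin 3)) →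
          x.2 ∈ insert d ({c} : Finset (Fin 3)) → False := by
        intro x hx h1 h2
        simp only [Finset.mem_insert, Finset.mem_singleton] at h1 h2
        rcases hmemT₀ x hx with h | h | h
        · rw [h] at h2; exact h2.elim hed hec
        · rw [h] at h2; exact h2.elim hed hec
        · rw [h] at h1; exact h1.elim (Ne.symm hst) htr
      have hz := height_ker_aeval_piecewise_add_card_le (K := K) a T₀ hT₀zero
      have hsr' : s ∉ ({r} : Finset (Fin 3)) := by simpa using hsr
      have hdc' : d ∉ ({c} : Finset (Fin 3)) := by simpa using hdc
      have hstep := height_ker_aeval_piecewise_insert (K := K) a T₀ (s, d)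
        (rsubperm (mvPolynomialX (Fin 3) (Fin 3) K) (· ∈ insert d ({c} : Finset (Fin 3)))
          (· ∈ insert s ({r} : Finset (Fin 3)))) ?_ ?_
      rotate_left
      · rw [aeval_rowWitness_of_notMem a (fun x hx h1 h2 => hfree x hx h1 h2),
          rsubperm_pair _ hsr hdc, map_eq_zero_iff _ (C_injective _ _)]
        simp only [Matrix.of_apply]
        linear_combination hvan r s c d (Ne.symm hsr) (Ne.symm hdc)
      · rw [aeval_rowWitness_of_mem a hsr' hdc' (T := insert (s, d) T₀)
          (fun x hx h1 h2 => ?_) (Finset.mem_insert_self _ _), rsubperm_singleton,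
          Matrix.of_apply]
        · exact X_mul_C_add_C_ne_zero hc
        · rcases Finset.mem_insert.1 hx with h | h
          · exact h
          · exact (hfree x h h1 h2).elim
      have h1' : (1 : ℕ∞) ≤ (RingHom.ker (aeval (R := K)
          (T₀.piecewise X (C ∘ a) : Fin 3 × Fin 3 → MvPolynomial (Fin 3 × Fin 3) L))).height :=
        le_add_self.trans hstep
      have htot := (add_le_add h1' le_rfl).trans hz
      rw [ker_aeval_piecewise_empty, hT₀card] at htot
      refine le_trans ?_ htot
      exact_mod_cast (by norm_num : 6 ≤ 1 + 5)
    -- assembly over the two other rows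
    obtain ⟨s, t, hsr, htr, hst⟩ := fin3_exists_others r
    by_cases hsc : a (s, c) = 0
    · have hs0 := rowA s hsr hsc
      by_cases htc : a (t, c) = 0
      · exact dead2 s t hst hs0 (rowA t htr htc)
      · exact live1 t s htr hsr (Ne.symm hst) htc hs0
    · by_cases htc : a (t, c) = 0
      · exact live1 s t hsr htr hst hsc (rowA t htr htc)
      · exact (twoLive s t hsr htr hst hsc htc).elim

/-- **Every prime over the `2 × 2` permanents of the generic `3 × 3` matrix has height `≥ 6`**
(`2 ≠ 0` in `F`, every field): the generic point of `F[X]/P` is a `3 × 3` matrix over a domain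
with vanishing `2 × 2` permanents. [cite: AlperBogartVelasco2017, §1 (sentence introducing Cor. 1.4), arXiv text p0003 L38] -/
theorem six_le_height_of_subpermIdeal_three_le (F : Type*) [Field F] (h2 : (2 : F) ≠ 0)
    (P : Ideal (MvPolynomial (Fin 3 × Fin 3) F)) [P.IsPrime] (hP : subpermIdeal F 3 3 2 ≤ P) :
    (6 : ℕ∞) ≤ P.height := by
  classical
  let a : Fin 3 × Fin 3 → MvPolynomial (Fin 3 × Fin 3) F ⧸ P := fun x => Ideal.Quotient.mk P (X x)
  have hker := ker_aeval_quotientMk (K := F) P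
  have hvan : ∀ r s i j : Fin 3, r ≠ s → i ≠ j →
      a (r, i) * a (s, j) + a (r, j) * a (s, i) = 0 := by
    intro r s i j hrs hij
    have hmem : rsubperm (mvPolynomialX (Fin 3) (Fin 3) F) (· ∈ ({i, j} : Finset (Fin 3)))
        (· ∈ ({r, s} : Finset (Fin 3))) ∈ P :=
      hP (rsubperm_mem_subpermIdeal (Finset.card_pair hrs) (Finset.card_pair hij))
    rw [← hker, RingHom.mem_ker, aeval_rsubperm_X, rsubperm_pair _ hrs hij] at hmem
    simpa only [Matrix.of_apply] using hmem
  rw [← hker]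
  exact height_ker_aeval_ge_of_threeByThree h2 a hvan

/-- A lower bound valid for every prime over `I` bounds the height of `I`. [folklore] -/
private theorem le_height_of_forall_isPrime' {A : Type*} [CommRing A] {I : Ideal A} {c : ℕ∞}
    (h : ∀ P : Ideal A, P.IsPrime → I ≤ P → c ≤ P.height) : c ≤ I.height := by
  rw [Ideal.height_eq_inf_minimalPrimes]
  exact le_iInf₂ fun P hP => h P hP.1.1 hP.1.2

end AlperBogartVelasco

/-- **`ht I(P₂(3 × 3)) = 6`** in the vocabulary of Boralevi–Carlini–Michałek–Ventura: the ideal of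
the `2 × 2` permanents of the generic `3 × 3` matrix (`= Sing` of the `3 × 3` permanental
hypersurface, `{prk ≤ 1}`) has height exactly `6 = 2k` when `2 ≠ 0` in `F` — the case `k = 3` of
von zur Gathen's problem (BCMV Thm. 4.14: `5 ≤ codim ≤ 2k`; "currently unknown for `k ≥ 5`").
Upper bound: the tree's `alperBogartVelasco2017_rem_1_5` (two zero columns) through
`singPermIdeal_eq_subpermIdeal`. [cite: AlperBogartVelasco2017, §1 (sentence introducing Cor. 1.4), arXiv text p0003 L38] -/
theorem BoraleviCarliniMichalekVentura2025.height_subpermIdeal_three_three_two (F : Type*)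
    [Field F] (h2 : (2 : F) ≠ 0) : (subpermIdeal F 3 3 2).height = 6 := by
  apply le_antisymm
  · have h := alperBogartVelasco2017_rem_1_5 F (n := 3) (by norm_num)
    rw [singIdeal_perPoly, singPermIdeal_eq_subpermIdeal F (m := 3) (by norm_num)] at h
    exact_mod_cast h
  · exact AlperBogartVelasco.le_height_of_forall_isPrime' fun P hP hle => by
      haveI := hP
      exact AlperBogartVelasco.six_le_height_of_subpermIdeal_three_le F h2 P hle

/-- **Alper–Bogart–Velasco 2017, §1: `codim(Sing(perm_3)) = 6`** ("Since it can be readily computed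
that `codim(Sing(perm_3)) = 6` and `codim(Sing(perm_4)) = 8` (c.f. [von-zur-gathen]), we obtain:
Corollary 1.4"), AS PRINTED for `perm_3`, in the tree's convention `codim Sing(f) = ht (f, ∂f)`:
over every field with `2 ≠ 0` (ABV: `char(k) ≠ 2`), `ht (per₃, ∂per₃/∂x_ij) = 6`
(`VonZurGathen.singPermIdeal F 3 = singIdeal (perPoly (Fin 3) F)` by `singIdeal_perPoly`, `rfl`).
The hypothesis `2 ≠ 0` is necessary in substance: in characteristic `2`, `per₃ = det₃` and
`Sing(det₃) = {rk ≤ 1}` has codimension `4`.  Together with `alperBogartVelasco2017_cor_1_3` this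
is the printed route to `dc(perm_3) ≥ 7` (the tree's `alperBogartVelasco2017_cor_1_4_holds` is not
restated).  NOT typed: the clause `codim(Sing(perm_4)) = 8`.
[cite: AlperBogartVelasco2017, §1 (sentence introducing Cor. 1.4), arXiv text p0003 L38] -/
theorem height_singPermIdeal_three (F : Type*) [Field F] (h2 : (2 : F) ≠ 0) :
    (VonZurGathen.singPermIdeal F 3).height = 6 := by
  rw [singPermIdeal_eq_subpermIdeal F (m := 3) (by norm_num)]
  exact BoraleviCarliniMichalekVentura2025.height_subpermIdeal_three_three_two F h2

/-- **Boralevi–Carlini–Michałek–Ventura 2025, Theorem 4.14 (von zur Gathen [VG])** ("Let `k ≥ 3`.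
The singular locus `Sing(P) = {prk(M) ≤ k−2}` has codimension between `5` and `2k`."), height
form, BY CITATION of tree theorems: `5 ≤ ht (per_k, ∂per_k/∂x_ij) ≤ 2k` for `k ≥ 3` over every
field with `(2 : F) ≠ 0` ⊋ the printed `ℂ` (§4).  Lower bound = von zur Gathen 1987, Lemma 2.3
(the tree's `five_le_height_singIdeal_perPoly` / `vonzurGathen1987_singPerm_height_holds`); upper
bound = Alper–Bogart–Velasco Rem. 1.5 (`alperBogartVelasco2017_rem_1_5`, two zero columns).  The
case `k = 3` is sharp at `2k` (`height_singPermIdeal_three`); `k = 4` (`= 8`) is NOT typed;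
`k ≥ 5` is open in print ("currently unknown", p0012 L36).
[cite: BoraleviCarliniMichalekVentura2025, Thm. 4.14 (arXiv text p0012 L40–41)] -/
theorem BoraleviCarliniMichalekVentura2025.thm_4_14 (F : Type*) [Field F] (h2 : (2 : F) ≠ 0)
    {k : ℕ} (hk : 3 ≤ k) :
    (5 : ℕ∞) ≤ (VonZurGathen.singPermIdeal F k).height ∧
      (VonZurGathen.singPermIdeal F k).height ≤ 2 * k := by
  rw [← singIdeal_perPoly]
  exact ⟨five_le_height_singIdeal_perPoly h2 hk,
    alperBogartVelasco2017_rem_1_5 F (by omega)⟩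

end Literature.Computability.AlgebraicComplexity
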